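import Summits.BirchSwinnertonDyer.BirchSwinnertonDyer.Theorems.Rank1ResidualJetSelmerLemmas
import HarnessLib

/-!
# T1 JET (cell `bsd-jet`), road K: the LOCAL transverse family `𝒯` and the reconciliation `hT` of
# `JET.tamagawaExponent_le_mInfty_of_kernelInputs`, REDUCED to the functoriality of restriction on
# local cohomology (gap G2 of sheet PV2-J6-S2-DESIGN)

HONEST FRAMING (programme file §HONESTY, verbatim): «no tranche here proves BSD; ARM L moves the
LITERAL column of an r ≤ 1 census into the kernel-proved-modulo-named-print column.» THEOREMS ONLY
(seat `bsd-jet-pv-2`, session g3; `--supports stmt-BirchSwinnertonDyer-14418`, helper); 0 classes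
move. WHAT THIS IS. The assembly `JET.tamagawaExponent_le_mInfty_of_kernelInputs` (p501299) takes a
structure-level transverse family `𝒯` (a local condition at each place dividing `c`) together with the
reconciliation `hT`: «`loc_w x ∈ 𝒯_w` for all `w ∣ c` iff `x ∈ transverseKer ℓ` for all `ℓ ∣ c`»
(lit-ty's GLOBAL rendering `Jetchev2008.transverseKer` of [J] §3.1.2 `H¹_tr(K_λ) = ker(H¹(K_λ) →
H¹(K[ℓ]_λ))`). Here `𝒯` is PRODUCED — `𝒯_w := loc_w(⋂_{ℓ ∣ c, ℓ ∈ w} transverseKer ℓ)` — and `hT` PROVED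
from the one infrastructure statement the tree lacks (design note PV2-J6-S2-DESIGN gap G2, [J] §3.1.2
«functoriality of restriction»): at every place `λ` of `K` over a prime `ℓ ∣ c` and every place `w'` of
`K[ℓ]` over `ℓ`, the localisation at `λ` of a class that dies at `K_λ` dies at `K[ℓ]_{w'}` after
restriction to `K[ℓ]` — stated as the existence of a comparison homomorphism
`r : H¹(K_λ, E[n]) → H¹(K[ℓ]_{w'}, E[n])` with `r ∘ loc_λ = loc_{w'} ∘ res_{K[ℓ]/K}` (`hcompat`). So the
`hT`/`𝒯` input of road K is exactly G2 and nothing else. References: [cite: Jetchev2008, §3.1.2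
(p. 814), §3.4.1 (p. 816)] [cite: MilneADT2006, I.§1 (restriction and localisation)].
-/

set_option autoImplicit false

noncomputable section

open scoped Classical

open WeierstrassCurve IsDedekindDomain NumberField Literature.NumberTheory.EllipticCurves
  Literature.NumberTheory.EllipticCurves.ModularForms Literature.NumberTheory.EllipticCurves.Jetchev2008
  Literature.NumberTheory.GaloisRepresentations
  Literature.NumberTheory.GaloisRepresentations.DiscreteGaloisModule

namespace Summit.BirchSwinnertonDyer.Rank1Residual.JET

variable {K : Type} [Field K] [NumberField K]

/-- **The local transverse family from the global transverse conditions, and its reconciliation `hT`,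
modulo the functoriality of restriction on local cohomology (G2).** For `W/ℚ`, a level `n`, an embedding
`ι`, a conductor `c ≠ 0`: IF at every place `λ` of `K` containing a prime factor `ℓ` of `c` and every
place `w'` of `K[ℓ]` containing `ℓ` there is a homomorphism `r : H¹(K_λ, E[n]) → H¹(K[ℓ]_{w'}, E[n])`
with `r (loc_λ x) = loc_{w'} (res_{K[ℓ]/K} x)` for all `x` (`hcompat` — restriction along
`K_λ ⊆ K[ℓ]_{w'}`), THEN the Selmer structure `𝒯` with `𝒯_λ := loc_λ(⋂_{ℓ ∣ c, ℓ ∈ λ} transverseKer ℓ)`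
at the finite places (and everything at the infinite places) satisfies the reconciliation `hT` of the
road-K assembly: for every `x ∈ H¹(K, E[n])`, `loc_λ x ∈ 𝒯_λ` for all `λ ∣ c` iff `x ∈ transverseKer ℓ`
for all `ℓ ∣ c`. (`⇐` is tautological; `⇒` uses `ker loc_λ ≤ transverseKer ℓ`, which is what `hcompat`
gives.) [cite: Jetchev2008, §3.1.2 (p. 814), §3.4.1 (p. 816)] -/
theorem exists_transverseFamily_of_compat (W : WeierstrassCurve ℚ) (ι : K →+* ℂ) (n : ℤ)
    [∀ k : ℕ, NumberField (ringClassField K ι k)] {c : ℕ} (hc : c ≠ 0)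
    (hcompat : ∀ ℓ ∈ c.primeFactors, ∀ (v : HeightOneSpectrum (𝓞 K)), (ℓ : 𝓞 K) ∈ v.asIdeal →
      ∀ (w' : HeightOneSpectrum (𝓞 (ringClassField K ι ℓ))),
        (ℓ : 𝓞 (ringClassField K ι ℓ)) ∈ w'.asIdeal →
      ∃ r : galoisCohomology (((W.baseChange K).torsionGaloisModule n).toLocal
            (Sum.inr v : Place K)) 1 →+
          galoisCohomology (DiscreteGaloisModule.toLocal
            (((W.baseChange K).torsionGaloisModule n).restrictField (ringClassField K ι ℓ))
            (Sum.inr w' : Place (ringClassField K ι ℓ))) 1,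
        ∀ x : galoisCohomology ((W.baseChange K).torsionGaloisModule n) 1,
          r (galoisCohomology.localization ((W.baseChange K).torsionGaloisModule n) (Sum.inr v) 1 x) =
            galoisCohomology.localization
              (((W.baseChange K).torsionGaloisModule n).restrictField (ringClassField K ι ℓ))
              (Sum.inr w') 1
              (galoisCohomology.res ((W.baseChange K).torsionGaloisModule n) (ringClassField K ι ℓ) 1 x)) :
    ∃ 𝒯 : SelmerStructure ((W.baseChange K).torsionGaloisModule n),
      (∀ v : HeightOneSpectrum (𝓞 K), 𝒯 (Sum.inr v) =
        (⨅ ℓ ∈ c.primeFactors.filter (fun ℓ : ℕ ↦ ((ℓ : ℕ) : 𝓞 K) ∈ v.asIdeal), transverseKer W K ι n ℓ).map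
          (galoisCohomology.localization ((W.baseChange K).torsionGaloisModule n) (Sum.inr v) 1)) ∧
      ∀ x : galoisCohomology ((W.baseChange K).torsionGaloisModule n) 1,
        (∀ w ∈ placesDividing K c,
          galoisCohomology.localization ((W.baseChange K).torsionGaloisModule n) (Sum.inr w) 1 x ∈
            𝒯 (Sum.inr w)) ↔
        ∀ ℓ ∈ c.primeFactors, x ∈ transverseKer W K ι n ℓ := by
  -- notation
  let ρ := (W.baseChange K).torsionGaloisModule n
  let loc : ∀ v : HeightOneSpectrum (𝓞 K),
      galoisCohomology ρ 1 →+ galoisCohomology (ρ.toLocal (Sum.inr v : Place K)) 1 :=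
    fun v ↦ galoisCohomology.localization ρ (Sum.inr v) 1
  let T : HeightOneSpectrum (𝓞 K) → AddSubgroup (galoisCohomology ρ 1) := fun v ↦
    ⨅ ℓ ∈ c.primeFactors.filter (fun ℓ : ℕ ↦ ((ℓ : ℕ) : 𝓞 K) ∈ v.asIdeal), transverseKer W K ι n ℓ
  let 𝒯 : SelmerStructure ρ := fun v ↦
    match v with
    | Sum.inl _ => ⊤
    | Sum.inr v => (T v).map (loc v)
  -- `ker loc_λ ≤ transverseKer ℓ` for `ℓ ∈ λ` (from `hcompat`)
  have hker : ∀ ℓ ∈ c.primeFactors, ∀ (v : HeightOneSpectrum (𝓞 K)), (ℓ : 𝓞 K) ∈ v.asIdeal →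
      ∀ x : galoisCohomology ρ 1, loc v x = 0 → x ∈ transverseKer W K ι n ℓ := by
    intro ℓ hℓ v hv x hx
    rw [mem_transverseKer_iff]
    intro w' hw'
    obtain ⟨r, hr⟩ := hcompat ℓ hℓ v hv w' hw'
    rw [← hr x]
    change r (loc v x) = 0
    rw [hx, map_zero]
  have hmemT : ∀ (v : HeightOneSpectrum (𝓞 K)) (x : galoisCohomology ρ 1),
      x ∈ T v ↔ ∀ ℓ ∈ c.primeFactors, (ℓ : 𝓞 K) ∈ v.asIdeal → x ∈ transverseKer W K ι n ℓ := by
    intro v x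
    simp only [T, AddSubgroup.mem_iInf, Finset.mem_filter, and_imp]
  refine ⟨𝒯, fun v ↦ rfl, fun x ↦ ⟨fun h ℓ hℓ ↦ ?_, fun h w hw ↦ ?_⟩⟩
  · -- `⇒`: a place `λ` of `K` over `ℓ` divides `c`; there `loc_λ x = loc_λ y` with `y ∈ T λ`
    have hℓp : ℓ.Prime := Nat.prime_of_mem_primeFactors hℓ
    obtain ⟨w, hwℓ⟩ : ∃ w : HeightOneSpectrum (𝓞 K), (ℓ : 𝓞 K) ∈ w.asIdeal := by
      haveI hmax : (Ideal.span {(ℓ : ℤ)}).IsMaximal :=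
        PrincipalIdealRing.isMaximal_of_irreducible (Nat.prime_iff_prime_int.mp hℓp).irreducible
      obtain ⟨Q, hQmax, hQ⟩ := Ideal.exists_ideal_over_maximal_of_isIntegral (S := 𝓞 K)
        (Ideal.span {(ℓ : ℤ)}) (by
          rw [(RingHom.injective_iff_ker_eq_bot _).mp (algebraMap ℤ (𝓞 K)).injective_int]
          exact bot_le)
      have hQ' : (ℓ : 𝓞 K) ∈ Q := by
        have : (ℓ : ℤ) ∈ Q.comap (algebraMap ℤ (𝓞 K)) := by
          rw [hQ]; exact Ideal.mem_span_singleton_self _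
        simpa [Ideal.mem_comap] using this
      have hQne : Q ≠ ⊥ := by
        intro hbot
        rw [hbot, Ideal.mem_bot] at hQ'
        exact hℓp.ne_zero (by exact_mod_cast hQ')
      exact ⟨⟨Q, hQmax.isPrime, hQne⟩, hQ'⟩
    have hwc : w ∈ placesDividing K c := by
      rw [SelmerVocabulary.mem_placesDividing_iff_natCast_mem hc]
      obtain ⟨q, hq⟩ := Nat.dvd_of_mem_primeFactors hℓ
      rw [hq, Nat.cast_mul]
      exact w.asIdeal.mul_mem_right _ hwℓ
    obtain ⟨y, hy, hyx⟩ := AddSubgroup.mem_map.mp (h w hwc)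
    have hyℓ : y ∈ transverseKer W K ι n ℓ := (hmemT w y).mp hy ℓ hℓ hwℓ
    have hxy : x - y ∈ transverseKer W K ι n ℓ :=
      hker ℓ hℓ w hwℓ (x - y) (by rw [map_sub, sub_eq_zero]; exact hyx.symm)
    have hsum := AddSubgroup.add_mem _ hxy hyℓ
    rwa [sub_add_cancel] at hsum
  · -- `⇐`: `x ∈ T w`, so `loc_w x ∈ 𝒯_w`
    exact AddSubgroup.mem_map.mpr ⟨x, (hmemT w x).mpr (fun ℓ hℓ _ ↦ h ℓ hℓ), rfl⟩

end Summit.BirchSwinnertonDyer.Rank1Residual.JET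

end
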